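import Summits.Ventures.PercRepro.RankLevelSetExplicitLin2Key
import Summits.Ventures.PercRepro.RankLevelSetExplicitLin2RowTen

/-!
# PercRepro — THE LEVEL-11 ROW OF C-025 FROM THE CHAIN'S OWN FLOOR `p ≥ 18 780` (p9, S4)

`proofs/SUBCLAIM-S4-p9.md` §S4.3⁗. THEOREM U states level `11` from `p ≥ 45 057` (`q·2^{q+1} + 1`). The assembled
inequality `(P_d)` of its chain holds, exactly evaluated, at EVERY core corank `12 ≤ d ≤ 2059` from `p = 18 780` — and fails at
`p = 18 779` (corank `1 268`): the integer key `KeyP 11 18780 d` (RankLevelSetExplicitLin2Key) is checked by the kernel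
at the 2 048 coranks (`decide`, 1 chunk of 2 048), the key is monotone in the rank (`keyP_mono`), and the wrapper
`c025_level_succ_of_keyP_row` assembles the level from the level-10 row `c025_ten_from_8710` (RankLevelSetExplicitLin2RowTen):
**`c025_eleven_from_18780 (M) (p) (hp : 18780 ≤ p) : RLS M p 11`** — the level-11 threshold `45 057` of THEOREM U
becomes `18 780` (`0.417·q·2^{q+1}`), the floor of the counting method itself. Axioms: standard.
-/

open scoped Matroid

namespace PercRepro

namespace ThmN

namespace Explicit

/-- **THE KEY ROW AT `(q, p) = (11, 18 780)`**: `KeyP 11 18780 d` at every corank `12 ≤ d ≤ 2059`, by the kernel. -/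
theorem key_eleven_row : ∀ t < 2048, KeyP 11 18780 (12 + t) := by decide +kernel

/-- **THE FLOOR IS EXACT**: the key FAILS at `p = 18 779`, corank `1 268` (the big class's saturation corank), by the kernel. -/
theorem key_eleven_sharp : ¬ KeyP 11 18779 1268 := by decide +kernel

end Explicit

variable {α : Type}

/-- **THE LEVEL-11 ROW FROM `18 780`**: C-025 at level `11` for every finite matroid and every `p ≥ 18 780` — the key row
at `18 780`, its monotonicity in `p`, the wrapper `c025_level_succ_of_keyP_row` (`N₁(11) = 4 386`, tail `6 215`) and
the level-10 row `c025_ten_from_8710` (RankLevelSetExplicitLin2RowTen) at `p − 1`. -/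
theorem c025_eleven_from_18780 (M : Matroid α) [M.Finite] (p : ℕ) (hp : 18780 ≤ p) : RLS M p 11 :=
  c025_level_succ_of_keyP_row 10 (by norm_num) 18780 (by norm_num) (by norm_num) Explicit.key_eleven_row
    (fun M' _ p' hp' => c025_ten_from_8710 M' p' (by omega)) M p hp

/-- The same in the literal `C025` body: `phiK p 11 · #U(p, 11) ≤ #Y(p, 11)` for every finite matroid and every `p ≥ 18 780`. -/
theorem c025_eleven_from_18780' (M : Matroid α) [M.Finite] (p : ℕ) (hp : 18780 ≤ p) :
    phiK p 11 * ({A : Set α | A ⊆ M.E ∧ M.eRk A = (p : ℕ∞) ∧ M.eRk (M.E \ A) = (11 : ℕ∞)}.ncard : ℚ) ≤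
      ({A : Set α | A ⊆ M.E ∧ (11 : ℕ∞) < M.eRk A ∧ M.eRk A < (p : ℕ∞)}.ncard : ℚ) :=
  c025_eleven_from_18780 M p hp

end ThmN

end PercRepro
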